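import Summits.RiemannHypothesis.RiemannHypothesis.Theorems.EvenSectorBartaEvenOneSignedWindowsTwoLevelProximity
import HarnessLib

/-!
# Gap transfer: a CERTIFIABLE second-level bound (orthogonal to a known direction) implies the
# second-level bound orthogonal to the UNKNOWN ground state
(route `RiemannHypothesis/GroundBarta`, crux `PolarPerronFrobenius` = stmt-RiemannHypothesis-18390, helper;
also serves `EvenSectorBarta.EvenOneSignedWindows` stmt-19953 route F8 step (s2) and `OddSector.OddOneSignedWindows`
stmt-17778 stub `stub_twoLevelProximity`; RH-free, no definitions, no named facts, no sorry)

The two-level ("min–max") proximity inequalities in the tree (`OddSector.twoLevelProximity`,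
`PolarPerronFrobenius.evenTwoLevelProximity`) consume a lower bound `m₂` for `Re Q` on the window tests
ORTHOGONAL TO THE GROUND STATE `u` — an object no certificate can see (`u` is only an `L²`-limit of a minimising
sequence).  What a certificate (deflation table, interval Gram bound) CAN establish is the same bound
orthogonal to an EXPLICIT direction `φ ∈ L²` (a Ritz vector, a window polynomial):

  `H(φ, m₂)`:  `m₂ ∫|k|² ≤ Re Q(k)` for every window test `k` of the sector with `∫ k φ̄ = 0`.

This file proves that `H(φ, m₂)` with `m₂ > ε` (the sector's bottom) implies the bound orthogonal to EVERY
ground state `u` of the sector, with the SAME constant `m₂` (no loss):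

  `m₂ ∫|h|² ≤ Re Q(h)` for every window test `h` of the sector with `∫ h ū = 0`.

Proof (Courant–Fischer's second step for a form known only through minimising sequences).  Let `gₙ → u` be
the sector's normalised minimising sequence with weak Euler–Lagrange identity `W(gₙ ⋆ h̃) → ε ∫ u h̄` (`= 0` for
`h ⊥ u`).  If `∫ h φ̄ = 0` the hypothesis applies to `h`.  Otherwise `xₙ = gₙ + μₙ h`, `μₙ = −(∫ gₙ φ̄)/(∫ h φ̄) → μ`,
is EXACTLY orthogonal to `φ`, so `m₂ ∫|xₙ|² ≤ Re Q(xₙ)`; polarisation (`OddSector.re_weilQuadratic_add_const_mul`,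
`W(h ⋆ g̃ₙ) = conj W(gₙ ⋆ h̃)`) and `∫ gₙ h̄ → 0` give in the limit `m₂ (1 + |μ|² ∫|h|²) ≤ ε + |μ|² Re Q(h)`
(`gapTransfer_limit`), and `m₂ > ε` forces `m₂ ∫|h|² ≤ Re Q(h)`.

Contents: `gapTransfer_limit` (limit bookkeeping); `gapTransfer_of_seq` (MASTER LEMMA, sequence form, sector =
any predicate `S` on tests closed under `gₙ + c h`); sector instances `even_secondLevel_of_gapCertificate`
(`IsWeilEvenGroundState`, `ε_ev`), `odd_secondLevel_of_gapCertificate` (`IsWeilOddGroundState`, `ε_od`),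
`secondLevel_of_gapCertificate` (`IsWeilGroundState`, `ε`), each with the sphere form that is LITERALLY the
hypothesis `H` of the tree's two-level proximity theorems; `gapCertificate_of_deflation` (the deflation shape
`m₂ ∫|k|² ≤ Re Q(k) + κ |∫ k φ̄|²` gives `H(φ, m₂)`); consequences `evenTwoLevelProximity_of_gapCertificate`,
`integral_norm_sq_sub_le_of_gapCertificate` (the `L²` form consumed by `oneSignedWindow_of_sourceCertificate`,
route F8 (s2)), `oddTwoLevelProximity_of_gapCertificate`, and the SIGN form
`even_groundState_almost_nonneg_of_gapCertificate`: `H(φ, m₂)` plus a NON-NEGATIVE even unit window test `v` with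
`Re Q(v) ≤ ε_ev + δ` force EVERY even-sector ground state, phase fixed, to have
`∫ ((Re u)⁻)² + (Im u)² ≤ 2δ/(m₂ − ε_ev)` — Perron–Frobenius up to `√(2δ/(m₂ − ε_ev))` in `L²`.
  With the landed cone data (`GroundBartaPolarPerronFrobeniusRitzSignNearBottom(83)`: `δ ↓ 483·10⁻²¹` at
  `a = 83/100`, `δ ↓ 10⁻¹⁷` at `4023/5000`) the one missing input for "every ground state at `0.83` is
  non-negative up to `10⁻³` in `L²`" is ONE even gap certificate `H(φ, m₂)`, `m₂ ≈ 10⁻¹³` (second even Ritz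
  value `3.4·10⁻¹³`).  Nothing here bears on RH; one window's sign has no bearing on RH.
References: M. Reed, B. Simon, *Methods of Modern Mathematical Physics IV*, Thm XIII.1–XIII.2 (min–max);
E. Bombieri, Rend. Mat. Acc. Lincei (9) 11 (2000), §4 Lemma 1 / (4.2), Thm 3, Thm 5 (`Bombieri2000Weil`);
T. Kato, J. Phys. Soc. Japan 4 (1949) 334–339 (Temple–Kato: the role of an a-priori second-level bound).
Prover B, speedrun unit `sr-gb-rung-b` (gen 17).
-/

noncomputable section

set_option linter.dupNamespace false

open Complex Filter Set MeasureTheory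
open scoped Real Topology ComplexConjugate

namespace Summit.RiemannHypothesis.RiemannHypothesis.Theorems.PolarPerronFrobenius

open Literature.NumberTheory.LFunctions
open Literature.NumberTheory.LFunctions.ConnesVanSuijlekom
open Summit.RiemannHypothesis.RiemannHypothesis.Theorems.GroundStatesConvergeToXi
open Summit.RiemannHypothesis.RiemannHypothesis.Theorems.OddSector
  (re_weilQuadratic_add_const_mul twoLevelProximity)

/-! ### The limit bookkeeping -/

/-- **Limit bookkeeping of the gap transfer.** Let `μₙ → μ`, `Aₙ → 0`, `Pₙ → 0` in `ℂ` and `Qgₙ → ε` in `ℝ`,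
and suppose that eventually `m₂ (1 + |μₙ|² Nh + 2 Re(μ̄ₙ Pₙ)) ≤ Qgₙ + |μₙ|² Qh + 2 Re(μₙ Aₙ)`.  Then
`m₂ (1 + |μ|² Nh) ≤ ε + |μ|² Qh`. [folklore] -/
theorem gapTransfer_limit {ε m₂ Qh Nh : ℝ} {μ : ℂ} {μs A P : ℕ → ℂ} {Qg : ℕ → ℝ}
    (hμ : Tendsto μs atTop (𝓝 μ)) (hA : Tendsto A atTop (𝓝 0)) (hP : Tendsto P atTop (𝓝 0))
    (hQ : Tendsto Qg atTop (𝓝 ε))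
    (hstep : ∀ᶠ n in atTop, m₂ * (1 + ‖μs n‖ ^ 2 * Nh + 2 * (conj (μs n) * P n).re) ≤
      Qg n + ‖μs n‖ ^ 2 * Qh + 2 * (μs n * A n).re) :
    m₂ * (1 + ‖μ‖ ^ 2 * Nh) ≤ ε + ‖μ‖ ^ 2 * Qh := by
  have hn2 : Tendsto (fun n => ‖μs n‖ ^ 2) atTop (𝓝 (‖μ‖ ^ 2)) := (hμ.norm).pow 2
  have h1 : Tendsto (fun n => (μs n * A n).re) atTop (𝓝 ((μ * 0).re)) :=
    (Complex.continuous_re.tendsto _).comp (hμ.mul hA)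
  have h2 : Tendsto (fun n => (conj (μs n) * P n).re) atTop (𝓝 ((conj μ * 0).re)) :=
    (Complex.continuous_re.tendsto _).comp (((Complex.continuous_conj.tendsto _).comp hμ).mul hP)
  rw [mul_zero, Complex.zero_re] at h1 h2
  have hF : Tendsto (fun n => (Qg n + ‖μs n‖ ^ 2 * Qh + 2 * (μs n * A n).re) -
      m₂ * (1 + ‖μs n‖ ^ 2 * Nh + 2 * (conj (μs n) * P n).re)) atTop
      (𝓝 ((ε + ‖μ‖ ^ 2 * Qh + 2 * 0) - m₂ * (1 + ‖μ‖ ^ 2 * Nh + 2 * 0))) :=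
    ((hQ.add (hn2.mul_const Qh)).add (h1.const_mul 2)).sub
      (((tendsto_const_nhds.add (hn2.mul_const Nh)).add (h2.const_mul 2)).const_mul m₂)
  have hlim : 0 ≤ (ε + ‖μ‖ ^ 2 * Qh + 2 * 0) - m₂ * (1 + ‖μ‖ ^ 2 * Nh + 2 * 0) :=
    ge_of_tendsto hF (hstep.mono fun n hn => sub_nonneg.2 hn)
  linarith

/-! ### The master lemma (sequence form, arbitrary sector) -/

/-- **Gap transfer, sequence form.**  Let `gₙ` be `L²`-normalised window tests with `Re Q(gₙ) → ε`
converging in `L²` to `u`, let `h` be a window test with the weak Euler–Lagrange limit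
`W(gₙ ⋆ h̃) → ε ∫ u h̄` and `∫ h ū = 0`, and let `S` be any predicate ("sector") with `S (gₙ + c h)` for all
`n` and `c : ℂ` and `S h`.  If `φ ∈ L²`, `m₂ > ε`, and `m₂ ∫|k|² ≤ Re Q(k)` for every window test `k` with `S k`
and `∫ k φ̄ = 0`, then `m₂ ∫|h|² ≤ Re Q(h)`.  (If `∫ h φ̄ = 0` this is the hypothesis; otherwise test the
hypothesis on `gₙ − ((∫ gₙ φ̄)/(∫ h φ̄)) h ⊥ φ`, expand by polarisation and pass to the limit,
`gapTransfer_limit`.) [cite: Bombieri2000Weil, §4 Lemma 1 / (4.2), Thm 3 (the variational identity of a minimiser)] -/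
theorem gapTransfer_of_seq {a ε m₂ : ℝ} {u φ h : ℝ → ℂ} {g : ℕ → ℝ → ℂ} (S : (ℝ → ℂ) → Prop)
    (hg : ∀ n, IsWeilTest (g n) ∧ tsupport (g n) ⊆ Icc (-a) a ∧ ∫ t, ‖g n t‖ ^ 2 = (1 : ℝ))
    (hQ : Tendsto (fun n => (weilQuadratic (g n)).re) atTop (𝓝 ε))
    (hu : MemLp u 2) (hL : Tendsto (fun n => ∫ t, ‖g n t - u t‖ ^ 2) atTop (𝓝 0))
    (hh : IsWeilTest h) (hhs : tsupport h ⊆ Icc (-a) a)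
    (hEL : Tendsto (fun n => weilFunctional (weilConv (g n) (weilReflect h))) atTop
      (𝓝 ((ε : ℂ) * ∫ t, u t * conj (h t))))
    (hS : ∀ n (c : ℂ), S (g n + fun t => c * h t)) (hSh : S h)
    (hφ : MemLp φ 2) (hm : ε < m₂)
    (H : ∀ k : ℝ → ℂ, IsWeilTest k → tsupport k ⊆ Icc (-a) a → S k →
      ∫ t, k t * conj (φ t) = 0 → m₂ * ∫ t, ‖k t‖ ^ 2 ≤ (weilQuadratic k).re)
    (horth : ∫ t, h t * conj (u t) = 0) :
    m₂ * ∫ t, ‖h t‖ ^ 2 ≤ (weilQuadratic h).re := by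
  by_cases hq : ∫ t, h t * conj (φ t) = 0
  · exact H h hh hhs hSh hq
  have hhm : MemLp h 2 := isWeilTest_memLp hh
  have hgm : ∀ n, MemLp (g n) 2 := fun n => isWeilTest_memLp (hg n).1
  set q : ℂ := ∫ t, h t * conj (φ t) with hqdef
  -- `pₙ = ⟨gₙ, φ⟩ → ⟨u, φ⟩`
  have hp : Tendsto (fun n => ∫ t, g n t * conj (φ t)) atTop (𝓝 (∫ t, u t * conj (φ t))) :=
    tendsto_integral_mul_conj_left hφ hu hgm hL
  set μ : ℂ := -((∫ t, u t * conj (φ t)) / q) with hμdef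
  set μs : ℕ → ℂ := fun n => -((∫ t, g n t * conj (φ t)) / q) with hμsdef
  have hμ : Tendsto μs atTop (𝓝 μ) := (hp.div_const q).neg
  -- `∫ u h̄ = conj ∫ h ū = 0`, `Pₙ = ∫ gₙ h̄ → 0`
  have hconj0 : ∫ t, u t * conj (h t) = 0 := by
    rw [← Complex.conj_conj (∫ t, u t * conj (h t)), ← integral_conj]
    simp only [map_mul, Complex.conj_conj, mul_comm (conj (u _)), horth, map_zero]
  have hP : Tendsto (fun n => ∫ t, g n t * conj (h t)) atTop (𝓝 0) := by
    have h1 := tendsto_integral_mul_conj_left hhm hu hgm hL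
    rwa [hconj0] at h1
  -- `Aₙ = W(h ⋆ g̃ₙ) = conj W(gₙ ⋆ h̃) → conj (ε ∫ u h̄) = 0`
  have hA : Tendsto (fun n => weilFunctional (weilConv h (weilReflect (g n)))) atTop (𝓝 0) := by
    have h1 : Tendsto (fun n => conj (weilFunctional (weilConv (g n) (weilReflect h)))) atTop
        (𝓝 (conj ((ε : ℂ) * ∫ t, u t * conj (h t)))) :=
      (Complex.continuous_conj.tendsto _).comp hEL
    rw [hconj0, mul_zero, map_zero] at h1
    refine h1.congr fun n => ?_
    exact (weilFunctional_weilConv_weilReflect_swap (g n) h).symm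
  -- the hypothesis on `xₙ = gₙ + μₙ h ⊥ φ`, expanded by polarisation
  have hstep : ∀ᶠ n in atTop,
      m₂ * (1 + ‖μs n‖ ^ 2 * (∫ t, ‖h t‖ ^ 2) + 2 * (conj (μs n) * ∫ t, g n t * conj (h t)).re) ≤
        (weilQuadratic (g n)).re + ‖μs n‖ ^ 2 * (weilQuadratic h).re +
          2 * (μs n * weilFunctional (weilConv h (weilReflect (g n)))).re := by
    refine Eventually.of_forall fun n => ?_
    have hxt : IsWeilTest (g n + fun t => μs n * h t) := (hg n).1.add (hh.const_mul _)
    have hxs : tsupport (g n + fun t => μs n * h t) ⊆ Icc (-a) a :=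
      (tsupport_add _ _).trans (union_subset (hg n).2.1 (tsupport_mul_subset_right.trans hhs))
    have hxorth : ∫ t, (g n + fun t => μs n * h t) t * conj (φ t) = 0 := by
      have e1 : (fun t => (g n + fun t => μs n * h t) t * conj (φ t)) =
          fun t => g n t * conj (φ t) + μs n * (h t * conj (φ t)) := by
        funext t
        simp only [Pi.add_apply]
        ring
      have i1 : Integrable fun t => g n t * conj (φ t) := (hgm n).integrable_mul (memLp_conj hφ)
      have i2 : Integrable fun t => μs n * (h t * conj (φ t)) :=
        (hhm.integrable_mul (memLp_conj hφ)).const_mul _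
      rw [e1, integral_add i1 i2, integral_const_mul]
      change (∫ t, g n t * conj (φ t)) + -((∫ t, g n t * conj (φ t)) / q) * q = 0
      rw [neg_mul, div_mul_cancel₀ _ hq, add_neg_cancel]
    have h1 := H _ hxt hxs (hS n (μs n)) hxorth
    rw [re_weilQuadratic_add_const_mul (hg n).1 hh (μs n)] at h1
    have e2 : ∫ t, ‖(g n + fun t => μs n * h t) t‖ ^ 2 =
        1 + ‖μs n‖ ^ 2 * (∫ t, ‖h t‖ ^ 2) + 2 * (conj (μs n) * ∫ t, g n t * conj (h t)).re := by
      have h2 := integral_norm_sq_add_mul (hgm n) hhm (μs n)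
      rw [(hg n).2.2, Complex.normSq_eq_norm_sq] at h2
      simpa only [Pi.add_apply] using h2
    rw [e2] at h1
    exact h1
  have hlim := gapTransfer_limit hμ hA hP hQ hstep
  refine le_of_not_gt fun hlt => ?_
  have h3 : ‖μ‖ ^ 2 * (weilQuadratic h).re ≤ ‖μ‖ ^ 2 * (m₂ * ∫ t, ‖h t‖ ^ 2) :=
    mul_le_mul_of_nonneg_left hlt.le (sq_nonneg _)
  nlinarith [hlim, h3, hm, sq_nonneg ‖μ‖]

/-! ### The three sectors -/

/-- **Gap transfer, EVEN sector.**  Let `u` be an even-sector ground state at window `a`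
(`ε_ev = weilEvenGroundEnergy a`), `φ ∈ L²`, and `m₂ > ε_ev` such that `m₂ ∫|k|² ≤ Re Q(k)` for every even
window test `k ⊥ φ`.  Then `m₂ ∫|h|² ≤ Re Q(h)` for every even window test `h ⊥ u`.
[cite: Bombieri2000Weil, §4 Lemma 1 / (4.2), Thm 3, Thm 5] -/
theorem even_secondLevel_of_gapCertificate {a m₂ : ℝ} {u φ : ℝ → ℂ}
    (hu : IsWeilEvenGroundState a u) (hm : weilEvenGroundEnergy a < m₂) (hφ : MemLp φ 2)
    (H : ∀ k : ℝ → ℂ, IsWeilTest k → tsupport k ⊆ Icc (-a) a → (∀ t, k (-t) = k t) →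
      ∫ t, k t * conj (φ t) = 0 → m₂ * ∫ t, ‖k t‖ ^ 2 ≤ (weilQuadratic k).re)
    {h : ℝ → ℂ} (hh : IsWeilTest h) (hhs : tsupport h ⊆ Icc (-a) a) (hhe : ∀ t, h (-t) = h t)
    (horth : ∫ t, h t * conj (u t) = 0) :
    m₂ * ∫ t, ‖h t‖ ^ 2 ≤ (weilQuadratic h).re := by
  obtain ⟨g, hg, hQ, hL, hEL⟩ := hu.exists_eulerLagrange_even
  refine gapTransfer_of_seq (fun k : ℝ → ℂ => ∀ t, k (-t) = k t)
    (fun n => ⟨(hg n).1, (hg n).2.1, (hg n).2.2.2⟩) hQ hu.memLp hL hh hhs (hEL h hh hhs hhe)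
    (fun n c t => ?_) hhe hφ hm (fun k hk hks hke hk0 => H k hk hks hke hk0) horth
  simp only [Pi.add_apply, (hg n).2.2.1 t, hhe t]

/-- **Gap transfer, EVEN sector, sphere form** (= the hypothesis `H` of `evenTwoLevelProximity`). [folklore] -/
theorem even_secondLevel_sphere_of_gapCertificate {a m₂ : ℝ} {u φ : ℝ → ℂ}
    (hu : IsWeilEvenGroundState a u) (hm : weilEvenGroundEnergy a < m₂) (hφ : MemLp φ 2)
    (H : ∀ k : ℝ → ℂ, IsWeilTest k → tsupport k ⊆ Icc (-a) a → (∀ t, k (-t) = k t) →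
      ∫ t, k t * conj (φ t) = 0 → m₂ * ∫ t, ‖k t‖ ^ 2 ≤ (weilQuadratic k).re) :
    ∀ h : ℝ → ℂ, IsWeilTest h → tsupport h ⊆ Icc (-a) a → (∀ t, h (-t) = h t) →
      ∫ t, ‖h t‖ ^ 2 = (1 : ℝ) → ∫ t, h t * conj (u t) = 0 → m₂ ≤ (weilQuadratic h).re := by
  intro h hh hhs hhe hh1 hh0
  have h1 := even_secondLevel_of_gapCertificate hu hm hφ H hh hhs hhe hh0
  rwa [hh1, mul_one] at h1

/-- **Gap transfer, ODD sector.**  Let `u` be an odd-sector ground state at window `a`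
(`ε_od = weilOddGroundEnergy a`), `φ ∈ L²`, and `m₂ > ε_od` such that `m₂ ∫|k|² ≤ Re Q(k)` for every odd window
test `k ⊥ φ`.  Then `m₂ ∫|h|² ≤ Re Q(h)` for every odd window test `h ⊥ u`.
[cite: Bombieri2000Weil, §4 Lemma 1 / (4.2), Thm 3, Thm 5] -/
theorem odd_secondLevel_of_gapCertificate {a m₂ : ℝ} {u φ : ℝ → ℂ}
    (hu : IsWeilOddGroundState a u) (hm : weilOddGroundEnergy a < m₂) (hφ : MemLp φ 2)
    (H : ∀ k : ℝ → ℂ, IsWeilTest k → tsupport k ⊆ Icc (-a) a → (∀ t, k (-t) = -k t) →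
      ∫ t, k t * conj (φ t) = 0 → m₂ * ∫ t, ‖k t‖ ^ 2 ≤ (weilQuadratic k).re)
    {h : ℝ → ℂ} (hh : IsWeilTest h) (hhs : tsupport h ⊆ Icc (-a) a) (hho : ∀ t, h (-t) = -h t)
    (horth : ∫ t, h t * conj (u t) = 0) :
    m₂ * ∫ t, ‖h t‖ ^ 2 ≤ (weilQuadratic h).re := by
  obtain ⟨g, hg, hQ, hL, hEL⟩ := hu.exists_eulerLagrange
  refine gapTransfer_of_seq (fun k : ℝ → ℂ => ∀ t, k (-t) = -k t)
    (fun n => ⟨(hg n).1, (hg n).2.1, (hg n).2.2.2⟩) hQ hu.memLp hL hh hhs (hEL h hh hhs)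
    (fun n c t => ?_) hho hφ hm (fun k hk hks hko hk0 => H k hk hks hko hk0) horth
  simp only [Pi.add_apply, (hg n).2.2.1 t, hho t]
  ring

/-- **Gap transfer, ODD sector, sphere form** (= the hypothesis `H` of `OddSector.twoLevelProximity`). [folklore] -/
theorem odd_secondLevel_sphere_of_gapCertificate {a m₂ : ℝ} {u φ : ℝ → ℂ}
    (hu : IsWeilOddGroundState a u) (hm : weilOddGroundEnergy a < m₂) (hφ : MemLp φ 2)
    (H : ∀ k : ℝ → ℂ, IsWeilTest k → tsupport k ⊆ Icc (-a) a → (∀ t, k (-t) = -k t) →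
      ∫ t, k t * conj (φ t) = 0 → m₂ * ∫ t, ‖k t‖ ^ 2 ≤ (weilQuadratic k).re) :
    ∀ h : ℝ → ℂ, IsWeilTest h → tsupport h ⊆ Icc (-a) a → (∀ t, h (-t) = -h t) →
      ∫ t, ‖h t‖ ^ 2 = (1 : ℝ) → ∫ t, h t * conj (u t) = 0 → m₂ ≤ (weilQuadratic h).re := by
  intro h hh hhs hho hh1 hh0
  have h1 := odd_secondLevel_of_gapCertificate hu hm hφ H hh hhs hho hh0
  rwa [hh1, mul_one] at h1

/-- **Gap transfer, FULL form.**  Let `u` be a ground state of the full windowed Weil form at `a`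
(`IsWeilGroundState a u`, bottom `ε(a) = weilGroundEnergy a`), `φ ∈ L²`, and `m₂ > ε(a)` such that
`m₂ ∫|k|² ≤ Re Q(k)` for every window test `k ⊥ φ`.  Then `m₂ ∫|h|² ≤ Re Q(h)` for every window test `h ⊥ u`.
[cite: Bombieri2000Weil, §4 Lemma 1 / (4.2), Thm 3] -/
theorem secondLevel_of_gapCertificate {a m₂ : ℝ} {u φ : ℝ → ℂ}
    (hu : IsWeilGroundState a u) (hm : weilGroundEnergy a < m₂) (hφ : MemLp φ 2)
    (H : ∀ k : ℝ → ℂ, IsWeilTest k → tsupport k ⊆ Icc (-a) a →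
      ∫ t, k t * conj (φ t) = 0 → m₂ * ∫ t, ‖k t‖ ^ 2 ≤ (weilQuadratic k).re)
    {h : ℝ → ℂ} (hh : IsWeilTest h) (hhs : tsupport h ⊆ Icc (-a) a)
    (horth : ∫ t, h t * conj (u t) = 0) :
    m₂ * ∫ t, ‖h t‖ ^ 2 ≤ (weilQuadratic h).re := by
  obtain ⟨hu2, g, hg, hQ, hL⟩ := hu
  exact gapTransfer_of_seq (fun _ : ℝ → ℂ => True) hg hQ hu2 hL hh hhs
    (groundState_eulerLagrange hg hQ hu2 hL hh hhs) (fun _ _ => trivial) trivial hφ hm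
    (fun k hk hks _ hk0 => H k hk hks hk0) horth

/-- **Gap transfer, FULL form, sphere form**: every normalised window test `h ⊥ u` has `m₂ ≤ Re Q(h)`. [folklore] -/
theorem secondLevel_sphere_of_gapCertificate {a m₂ : ℝ} {u φ : ℝ → ℂ}
    (hu : IsWeilGroundState a u) (hm : weilGroundEnergy a < m₂) (hφ : MemLp φ 2)
    (H : ∀ k : ℝ → ℂ, IsWeilTest k → tsupport k ⊆ Icc (-a) a →
      ∫ t, k t * conj (φ t) = 0 → m₂ * ∫ t, ‖k t‖ ^ 2 ≤ (weilQuadratic k).re) :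
    ∀ h : ℝ → ℂ, IsWeilTest h → tsupport h ⊆ Icc (-a) a →
      ∫ t, ‖h t‖ ^ 2 = (1 : ℝ) → ∫ t, h t * conj (u t) = 0 → m₂ ≤ (weilQuadratic h).re := by
  intro h hh hhs hh1 hh0
  have h1 := secondLevel_of_gapCertificate hu hm hφ H hh hhs hh0
  rwa [hh1, mul_one] at h1

/-! ### The deflation shape of a gap certificate -/

/-- **A one-direction deflation bound is a gap certificate.**  If, for every window test `k` of a sector `S`,
`m₂ ∫|k|² ≤ Re Q(k) + κ |∫ k φ̄|²` (the shape a deflation certificate proves: the form shifted UP by a rank-one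
multiple of the projection onto `φ` is bounded below by `m₂`), then `H(φ, m₂)` holds on `S`:
`m₂ ∫|k|² ≤ Re Q(k)` for every such `k ⊥ φ`. [folklore] -/
theorem gapCertificate_of_deflation {a m₂ κ : ℝ} {φ : ℝ → ℂ} (S : (ℝ → ℂ) → Prop)
    (hD : ∀ k : ℝ → ℂ, IsWeilTest k → tsupport k ⊆ Icc (-a) a → S k →
      m₂ * ∫ t, ‖k t‖ ^ 2 ≤ (weilQuadratic k).re + κ * ‖∫ t, k t * conj (φ t)‖ ^ 2) :
    ∀ k : ℝ → ℂ, IsWeilTest k → tsupport k ⊆ Icc (-a) a → S k →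
      ∫ t, k t * conj (φ t) = 0 → m₂ * ∫ t, ‖k t‖ ^ 2 ≤ (weilQuadratic k).re := by
  intro k hk hks hSk hk0
  have h1 := hD k hk hks hSk
  rwa [hk0, norm_zero, zero_pow two_ne_zero, mul_zero, add_zero] at h1

/-! ### Consequences: two-level proximity and almost-positivity from CERTIFIABLE data -/

/-- **Two-level proximity from a gap certificate (EVEN sector).**  Let `u` be an even-sector ground state at
`a`, `φ ∈ L²`, `m₂ > ε_ev(a)` with `H(φ, m₂)` on the even window tests.  Then every `L²`-normalised even window
test `v` satisfies `1 − |∫ v ū|² ≤ (Re Q(v) − ε_ev(a))/(m₂ − ε_ev(a))` (`evenTwoLevelProximity` with its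
hypothesis supplied by `even_secondLevel_sphere_of_gapCertificate`).
[cite: Bombieri2000Weil, §4 Lemma 1 / (4.2), Thm 3, Thm 5 and §9 Lemma 11] -/
theorem evenTwoLevelProximity_of_gapCertificate {a m₂ : ℝ} {u φ : ℝ → ℂ}
    (hu : IsWeilEvenGroundState a u) (hm : weilEvenGroundEnergy a < m₂) (hφ : MemLp φ 2)
    (H : ∀ k : ℝ → ℂ, IsWeilTest k → tsupport k ⊆ Icc (-a) a → (∀ t, k (-t) = k t) →
      ∫ t, k t * conj (φ t) = 0 → m₂ * ∫ t, ‖k t‖ ^ 2 ≤ (weilQuadratic k).re)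
    {v : ℝ → ℂ} (hv : IsWeilTest v) (hvs : tsupport v ⊆ Icc (-a) a) (hve : ∀ t, v (-t) = v t)
    (hv1 : ∫ t, ‖v t‖ ^ 2 = (1 : ℝ)) :
    1 - ‖∫ t, v t * conj (u t)‖ ^ 2 ≤
      ((weilQuadratic v).re - weilEvenGroundEnergy a) / (m₂ - weilEvenGroundEnergy a) :=
  evenTwoLevelProximity hu hm (even_secondLevel_sphere_of_gapCertificate hu hm hφ H) hv hvs hve hv1

/-- **The `L²`-distance form from a gap certificate (EVEN sector)** — what route F8 step (s2) consumes
(`oneSignedWindow_of_sourceCertificate`): under `H(φ, m₂)`, `m₂ > ε_ev(a)`, for every normalised even window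
test `v` whose pairing `∫ v ū` is real and `≥ 0` (fix the free phase of `u`),
`∫|v − u|² ≤ 2 (Re Q(v) − ε_ev(a))/(m₂ − ε_ev(a))`.
[cite: Bombieri2000Weil, §4 Thm 3 (minimising sequences converge in L²)] -/
theorem integral_norm_sq_sub_le_of_gapCertificate {a m₂ : ℝ} {u φ : ℝ → ℂ}
    (hu : IsWeilEvenGroundState a u) (hm : weilEvenGroundEnergy a < m₂) (hφ : MemLp φ 2)
    (H : ∀ k : ℝ → ℂ, IsWeilTest k → tsupport k ⊆ Icc (-a) a → (∀ t, k (-t) = k t) →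
      ∫ t, k t * conj (φ t) = 0 → m₂ * ∫ t, ‖k t‖ ^ 2 ≤ (weilQuadratic k).re)
    {v : ℝ → ℂ} (hv : IsWeilTest v) (hvs : tsupport v ⊆ Icc (-a) a) (hve : ∀ t, v (-t) = v t)
    (hv1 : ∫ t, ‖v t‖ ^ 2 = (1 : ℝ)) (hreal : (∫ t, v t * conj (u t)).im = 0)
    (hpos : 0 ≤ (∫ t, v t * conj (u t)).re) :
    ∫ t, ‖v t - u t‖ ^ 2 ≤
      2 * (((weilQuadratic v).re - weilEvenGroundEnergy a) / (m₂ - weilEvenGroundEnergy a)) :=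
  integral_norm_sq_sub_le_of_evenTwoLevelProximity hu hm
    (even_secondLevel_sphere_of_gapCertificate hu hm hφ H) hv hvs hve hv1 hreal hpos

/-- **Two-level proximity from a gap certificate (ODD sector)**: under `H(φ, m₂)` on the odd window tests,
`m₂ > ε_od(a)`, every `L²`-normalised odd window test `v` satisfies
`1 − |∫ v ū|² ≤ (Re Q(v) − ε_od(a))/(m₂ − ε_od(a))` for every odd-sector ground state `u`
(`OddSector.twoLevelProximity` with its hypothesis supplied by `odd_secondLevel_sphere_of_gapCertificate`).
[cite: Bombieri2000Weil, §4 Lemma 1 / (4.2), Thm 3, Thm 5] -/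
theorem oddTwoLevelProximity_of_gapCertificate {a m₂ : ℝ} {u φ : ℝ → ℂ}
    (hu : IsWeilOddGroundState a u) (hm : weilOddGroundEnergy a < m₂) (hφ : MemLp φ 2)
    (H : ∀ k : ℝ → ℂ, IsWeilTest k → tsupport k ⊆ Icc (-a) a → (∀ t, k (-t) = -k t) →
      ∫ t, k t * conj (φ t) = 0 → m₂ * ∫ t, ‖k t‖ ^ 2 ≤ (weilQuadratic k).re)
    {v : ℝ → ℂ} (hv : IsWeilTest v) (hvs : tsupport v ⊆ Icc (-a) a) (hvo : ∀ t, v (-t) = -v t)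
    (hv1 : ∫ t, ‖v t‖ ^ 2 = (1 : ℝ)) :
    1 - ‖∫ t, v t * conj (u t)‖ ^ 2 ≤
      ((weilQuadratic v).re - weilOddGroundEnergy a) / (m₂ - weilOddGroundEnergy a) :=
  twoLevelProximity hu hm (odd_secondLevel_sphere_of_gapCertificate hu hm hφ H) hv hvs hvo hv1

/-! ### The sign form: almost-positivity of every ground state -/

/-- **`L²`-closeness to a non-negative function controls the negative and imaginary parts.**  If `v` is real
and `≥ 0` pointwise and `∫|v − u|² ≤ ρ` (`u, v ∈ L²`), then `∫ ((Re u)⁻)² + (Im u)² ≤ ρ`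
(pointwise `((Re u)⁻)² + (Im u)² ≤ |v − u|²`). [folklore] -/
theorem integral_negPart_sq_add_im_sq_le {u v : ℝ → ℂ} {ρ : ℝ} (hu : MemLp u 2) (hv : MemLp v 2)
    (hv0 : ∀ t, (v t).im = 0 ∧ 0 ≤ (v t).re) (h : ∫ t, ‖v t - u t‖ ^ 2 ≤ ρ) :
    ∫ t, (max (-(u t).re) 0) ^ 2 + ((u t).im) ^ 2 ≤ ρ := by
  refine le_trans (integral_mono_of_nonneg (Eventually.of_forall fun t => ?_) ?_
    (Eventually.of_forall fun t => ?_)) h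
  · exact add_nonneg (sq_nonneg _) (sq_nonneg _)
  · exact (memLp_two_iff_integrable_sq_norm (hv.sub hu).1).1 (hv.sub hu)
  · -- pointwise: `((Re u)⁻)² + (Im u)² ≤ |v − u|² = (Re v − Re u)² + (Im u)²`
    obtain ⟨hvi, hvr⟩ := hv0 t
    have e : ‖v t - u t‖ ^ 2 = ((v t).re - (u t).re) ^ 2 + ((u t).im) ^ 2 := by
      rw [← Complex.normSq_eq_norm_sq, Complex.normSq_apply]
      simp only [Complex.sub_re, Complex.sub_im, hvi, zero_sub]
      ring
    rw [e]
    have hmax : (max (-(u t).re) 0) ^ 2 ≤ ((v t).re - (u t).re) ^ 2 := by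
      rcases le_or_gt 0 (u t).re with hnn | hneg
      · rw [max_eq_right (neg_nonpos.2 hnn), zero_pow two_ne_zero]
        positivity
      · rw [max_eq_left (neg_nonneg.2 hneg.le)]
        nlinarith
    linarith

/-- **Almost-positivity of EVERY even-sector ground state from certifiable data** (the quantitative
Perron–Frobenius statement a gap certificate buys).  Let `u` be an even-sector ground state at window `a`
(`ε_ev = weilEvenGroundEnergy a`), let `H(φ, m₂)` hold on the even window tests for some `φ ∈ L²` and
`m₂ > ε_ev`, and let `v` be an `L²`-normalised even window test that is REAL AND NON-NEGATIVE pointwise.  Then,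
after fixing the free phase of `u` (a unit scalar `c`), the negative part and the imaginary part of `c u` are
small in `L²`:  `∫ ((Re(c u))⁻)² + (Im(c u))² ≤ 2 (Re Q(v) − ε_ev)/(m₂ − ε_ev)`.
[cite: Bombieri2000Weil, §4 Thm 3, Thm 5] -/
theorem even_groundState_almost_nonneg_of_gapCertificate {a m₂ : ℝ} {u φ : ℝ → ℂ}
    (hu : IsWeilEvenGroundState a u) (hm : weilEvenGroundEnergy a < m₂) (hφ : MemLp φ 2)
    (H : ∀ k : ℝ → ℂ, IsWeilTest k → tsupport k ⊆ Icc (-a) a → (∀ t, k (-t) = k t) →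
      ∫ t, k t * conj (φ t) = 0 → m₂ * ∫ t, ‖k t‖ ^ 2 ≤ (weilQuadratic k).re)
    {v : ℝ → ℂ} (hv : IsWeilTest v) (hvs : tsupport v ⊆ Icc (-a) a) (hve : ∀ t, v (-t) = v t)
    (hv1 : ∫ t, ‖v t‖ ^ 2 = (1 : ℝ)) (hv0 : ∀ t, (v t).im = 0 ∧ 0 ≤ (v t).re) :
    ∃ c : ℂ, ‖c‖ = 1 ∧
      ∫ t, (max (-(c * u t).re) 0) ^ 2 + ((c * u t).im) ^ 2 ≤
        2 * (((weilQuadratic v).re - weilEvenGroundEnergy a) / (m₂ - weilEvenGroundEnergy a)) := by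
  -- fix the phase: `c` unit with `∫ v · conj (c u) = conj c · ∫ v ū` real and `≥ 0`
  set p : ℂ := ∫ t, v t * conj (u t) with hp
  obtain ⟨c, hc1, hcp⟩ : ∃ c : ℂ, ‖c‖ = 1 ∧ conj c * p = (‖p‖ : ℂ) := by
    by_cases hp0 : p = 0
    · exact ⟨1, norm_one, by simp [hp0]⟩
    · refine ⟨p / (‖p‖ : ℂ), ?_, ?_⟩
      · rw [norm_div, Complex.norm_real, Real.norm_of_nonneg (norm_nonneg _),
          div_self (norm_ne_zero_iff.2 hp0)]
      · have hn : (‖p‖ : ℂ) ≠ 0 := Complex.ofReal_ne_zero.2 (norm_ne_zero_iff.2 hp0)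
        rw [map_div₀, Complex.conj_ofReal, div_mul_eq_mul_div, div_eq_iff hn, Complex.conj_mul', sq]
  have hcu : IsWeilEvenGroundState a (fun t => c * u t) := hu.const_mul hc1
  have hpair : ∫ t, v t * conj (c * u t) = (‖p‖ : ℂ) := by
    have e : (fun t => v t * conj (c * u t)) = fun t => conj c * (v t * conj (u t)) := by
      funext t
      simp only [map_mul]
      ring
    rw [e, integral_const_mul, ← hp, hcp]
  have hreal : (∫ t, v t * conj (c * u t)).im = 0 := by
    rw [hpair, Complex.ofReal_im]
  have hpos : 0 ≤ (∫ t, v t * conj (c * u t)).re := by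
    rw [hpair, Complex.ofReal_re]
    exact norm_nonneg _
  refine ⟨c, hc1, ?_⟩
  have hdist := integral_norm_sq_sub_le_of_gapCertificate hcu hm hφ H hv hvs hve hv1 hreal hpos
  exact integral_negPart_sq_add_im_sq_le hcu.memLp (isWeilTest_memLp hv) hv0 hdist

end Summit.RiemannHypothesis.RiemannHypothesis.Theorems.PolarPerronFrobenius

end
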